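import Literature.Computability.Complexity.RoundInstance
import Literature.Computability.Complexity.GabberGalil
import HarnessLib

/-!
# Dinur's theorem on the Gabber–Galil expanders (the closed-form instance used at the machine level)

The expander kit (`RoundInstance.Kit`) built from the Margulis–Gabber–Galil graphs of
`GabberGalil.lean` — vertex-set expanders `XM n = (lazy G_{⌊√n⌋+1})^{pw}` on `(⌊√n⌋+1)² ≤ 4n` vertices
(`λ ≤ 1/10`), cloud edge-expanders of every size `k` by contracting `XM (2k)` (`Quotient.quot`, `8`
label blocks) — and the resulting instance of the combinatorial Dinur theorem.  Every rotation map here is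
a closed-form arithmetic expression (affine maps mod `m`, base-`16` digits of walk labels, `mod`/`div`
for the contraction), which is what the machine-level (polynomial-time) rendering of the reduction uses.

* `ggKit : Kit`, `ggP := ggKit.mkParams`, `ggP_good`;
* `gg_dinur_isExactWidth`, `gg_dinur_satisfiable`, `gg_dinur_maxSatFraction_le`, `gg_dinur_length_le`.

## References

* J. R. Lee, *On expanders from the action of GL(2,ℤ)*, arXiv:1301.6296 (2013), Thm. 2.3.
* S. Arora, B. Barak, *Computational Complexity: A Modern Approach*, CUP 2009, §22.2, Lemma 22.4, §22.A.
-/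

noncomputable section

namespace Literature.Computability.Complexity

open Finset

namespace GabberGalil

open Expander Expander.RotGraph Expander.RoundParams BLR.Table

/-- The number of label blocks of the contraction: `NM (2k) ≤ 4 · 2k = 8k`. [folklore] -/
def Cq : ℕ := 8

/-- The degree of the cloud expanders. [folklore] -/
def d₀ : ℕ := Cq * dM

/-- `d₀ > 0`. [folklore] -/
theorem d₀_pos : 0 < d₀ := Nat.mul_pos (by norm_num [Cq]) dM_pos

/-- `NM (2k) ≤ 8 k`. [folklore] -/
theorem NM_two_mul_le {k : ℕ} (hk : 0 < k) : NM (2 * k) ≤ Cq * k := by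
  have := NM_le (n := 2 * k) (by omega); rw [Cq]; omega

/-- **The cloud expanders**: the contraction of `XM (2k)` onto `k` vertices. [cite: AroraBarakCC2009, Exercise 21.16 and Claim 22.37] -/
def Xc (k : ℕ) : RotGraph k d₀ := quot (XM (2 * k)) k Cq fun hk => NM_two_mul_le hk

/-- The edge-expansion constant `η = dM (1 - 1/10)/2`. [folklore] -/
def ηc : ℝ := (dM : ℝ) * (1 - 1 / 10) / 2

/-- `η > 0`. [folklore] -/
theorem ηc_pos : 0 < ηc := by
  unfold ηc
  have : (0 : ℝ) < dM := by exact_mod_cast dM_pos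
  nlinarith

/-- Edge expansion of the cloud expanders. [cite: AroraBarakCC2009, Exercise 21.16] -/
theorem edgeExpansion_Xc (k : ℕ) (Q : Finset (Fin k)) (hQ : 2 * Q.card ≤ k) :
    ηc * Q.card ≤ ((univ.filter fun x : Fin k × Fin d₀ => x.1 ∈ Q ∧ (Xc k).nbr x.1 x.2 ∉ Q).card : ℝ) :=
  edgeExpansion_quot (XM (2 * k)) k Cq (fun hk => NM_two_mul_le hk) dM_pos (spectralBound_XM _) (by norm_num) (le_NM (2 * k)) Q hQ

/-- **The Gabber–Galil kit.** [cite: Lee2013GL2Z, Thm. 2.3; AroraBarakCC2009, §22.A] -/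
def ggKit : Kit where
  d₀ := d₀
  d₀_pos := d₀_pos
  X := Xc
  η := ηc
  η_pos := ηc_pos
  edgeExp := edgeExpansion_Xc
  dX := dM
  dX_pos := dM_pos
  Nx := NM
  Nx_ge := le_NM
  cN := 4
  cN_pos := by norm_num
  Nx_le := fun n hn => by exact_mod_cast NM_le hn
  XN := XM
  spectral := spectralBound_XM

/-- **The round parameters on the Gabber–Galil kit.** [cite: AroraBarakCC2009, Lemma 22.4] -/
def ggP : RoundParams := ggKit.mkParams

/-- They are good. [cite: AroraBarakCC2009, Lemma 22.4] -/
theorem ggP_good : ggP.Good := ggKit.mkParams_good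

/-- The output is an E3-CNF. [cite: AroraBarakCC2009, §22.4] -/
theorem gg_dinur_isExactWidth (φ : CNF ℕ) : (ggP.dinur φ).IsExactWidth 3 := ggP.isExactWidth_dinur φ

/-- **Completeness.** [cite: AroraBarakCC2009, §22.2] -/
theorem gg_dinur_satisfiable {φ : CNF ℕ} (hw : φ.IsWidthLE 3) (h : φ.Satisfiable) : (ggP.dinur φ).Satisfiable :=
  ggP.satisfiable_dinur hw h

/-- **Soundness.** [cite: AroraBarakCC2009, §22.2] -/
theorem gg_dinur_maxSatFraction_le {φ : CNF ℕ} (hw : φ.IsWidthLE 3) (h : ¬ φ.Satisfiable) :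
    ((ggP.dinur φ).maxSatFraction : ℝ) ≤ 1 - ggP.ε₁ :=
  ggP.maxSatFraction_dinur_le ggP_good hw h

/-- **Size.** [cite: AroraBarakCC2009, §22.2] -/
theorem gg_dinur_length_le (φ : CNF ℕ) :
    ((ggP.dinur φ).length : ℝ) ≤ ggP.roundC ^ (Nat.log 2 φ.length + 1) * φ.length * (2 ^ q₀ * (q₀ + 4)) :=
  ggP.length_dinur_le ggP_good φ

end GabberGalil

end Literature.Computability.Complexity

end
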